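import Literature.Probability.RandomPlanarGeometry.DrivingGermSampling
import HarnessLib

/-!
# Doob's maximal inequality along the germ filtration

Topic `Probability/RandomPlanarGeometry`, sub-namespace `SkorokhodEmbedding` (companion of
`DrivingGermSampling.lean`). Everything here is PROVED, on a finite probability space; no named
fact is introduced.

For a finite family of continuous paths `drv ω` read through the capacity sampling of
`DrivingCapacitySampling.lean`, the germ atoms `germAtom drv δ k ω` of `DrivingGermSampling.lean`
are the atoms of the filtration `𝒢_k` generated by the path up to the `k`-th stopping capacity:
they are equivalence classes (`germAtom_eq_of_mem`) and refine as `k` grows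
(`germAtom_subset_of_le`). On a finite space the conditional probability of an event `B` given
`𝒢_k` at `ω` is `P(B ∩ A) / P(A)` with `A = germAtom drv δ k ω`, and **Doob's maximal
inequality** for the martingale `P(B | 𝒢_k)`,

  `c · P(∃ k, P(B | 𝒢_k) ≥ c) ≤ P(B)`,

is `measureReal_setOf_exists_condProb_ge_le`, stated division-free as
`c · P {ω | ∃ k, c · P(A_k ω) ≤ P(B ∩ A_k ω)} ≤ P(B)`. The proof is the first-hitting-time
disjointification: the germ atoms taken at the FIRST step at which the conditional probability is
`≥ c` ("stopped atoms") are pairwise disjoint — two stopped atoms that meet coincide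
(`germAtom_eq_of_isFirst_of_mem`, by refinement and the class property) —, they cover the event,
and each carries a piece of `B` of probability at least `c` times its own; summing over the
finitely many stopped atoms gives the bound. The slightly more flexible
`mul_measureReal_setOf_exists_le` bounds `c · P(∃ k, p k)` by `P(B)` for any predicate `p k ω`
depending only on the germ atom of `ω` at step `k` all of whose atoms carry conditional
probability `≥ c` of `B`.

The corollary `measureReal_setOf_germViol_le_of_condProb` bounds the violation event
`{∃ k < N, germViol P drv δ κ C₁ C₂ k}` of the Lawler–Schramm–Werner key estimate — the single
probabilistic input left by `germ_sampledData_isValid` ([LSW04] §3.3) — by `P(Bad) / c` as soon as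
every violating germ atom before the horizon carries conditional probability `≥ c` of an event
`Bad`. This is the tool by which a key estimate proved along a FINER filtration (walk prefixes,
along which the domain Markov property acts) off a bad event of small probability is transferred
to the germ normal form: a germ atom is a disjoint union of atoms of the finer filtration, so a
germ atom violating the key bound while the good finer atoms satisfy it with a margin must give
the bad event conditional probability bounded below.

## References

* R. Durrett, *Probability: Theory and Examples*, 5th ed. (2019), Thm. 4.4.2 (Doob's inequality)
  [Durrett2019].
* G. F. Lawler, O. Schramm, W. Werner, *Conformal invariance of planar loop-erased random walks
  and uniform spanning trees*, Ann. Probab. 32 (2004), §3.3 [LawlerSchrammWerner2004].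
-/

noncomputable section

open MeasureTheory Filter Set
open scoped NNReal Topology

namespace Literature.Probability.RandomPlanarGeometry.SkorokhodEmbedding

/-! ### Stopped germ atoms -/

section First

variable {Ω : Type} {drv : Ω → C(ℝ≥0, ℝ)} {δ : ℝ}

/-- **Two stopped germ atoms that meet coincide.** If a predicate `p k ω` depends only on the
germ atom of `ω` at step `k`, and `k`, `k'` are the first steps at which it holds for `ω`, `ω'`
respectively, then the germ atoms `germAtom drv δ k ω`, `germAtom drv δ k' ω'` are equal as soon
as they have a common point (first-hitting-time disjointification, by refinement
`germAtom_subset_of_le` and the class property `germAtom_eq_of_mem`). [folklore] -/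
theorem germAtom_eq_of_isFirst_of_mem {p : ℕ → Ω → Prop}
    (hp : ∀ k ω ω', ω' ∈ germAtom drv δ k ω → (p k ω' ↔ p k ω))
    {k k' : ℕ} {ω ω' ω'' : Ω} (hk : p k ω) (hmin : ∀ j < k, ¬ p j ω)
    (hk' : p k' ω') (hmin' : ∀ j < k', ¬ p j ω')
    (h : ω'' ∈ germAtom drv δ k ω) (h' : ω'' ∈ germAtom drv δ k' ω') :
    germAtom drv δ k ω = germAtom drv δ k' ω' := by
  -- transfer the first-hitting data of `ω` and of `ω'` to the common point `ω''`
  have h₁ : p k ω'' := (hp _ _ _ h).2 hk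
  have h₁min : ∀ j < k, ¬ p j ω'' := fun j hj hpj ↦
    hmin j hj ((hp _ _ _ (germAtom_subset_of_le hj.le ω h)).1 hpj)
  have h₂ : p k' ω'' := (hp _ _ _ h').2 hk'
  have h₂min : ∀ j < k', ¬ p j ω'' := fun j hj hpj ↦
    hmin' j hj ((hp _ _ _ (germAtom_subset_of_le hj.le ω' h')).1 hpj)
  obtain rfl : k = k' :=
    le_antisymm (not_lt.1 fun hlt ↦ h₁min k' hlt h₂) (not_lt.1 fun hlt ↦ h₂min k hlt h₁)
  exact (germAtom_eq_of_mem h).symm.trans (germAtom_eq_of_mem h')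

end First

/-! ### Doob's maximal inequality -/

section Doob

variable {Ω : Type} [Fintype Ω] [MeasurableSpace Ω] [MeasurableSingletonClass Ω]

/-- **Doob's maximal inequality along the germ filtration, atomwise form.** On a finite measure
space, if a predicate `p k ω` depends only on the germ atom of `ω` at step `k` and every germ atom
on which it holds carries a piece of `B` of mass at least `c ≥ 0` times its own mass, then
`c · P {ω | ∃ k, p k ω} ≤ P(B)`: the event is covered by the pairwise disjoint stopped atoms
(`germAtom_eq_of_isFirst_of_mem`), over which one sums. [folklore] -/
theorem mul_measureReal_setOf_exists_le (P : Measure Ω) [IsFiniteMeasure P]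
    (drv : Ω → C(ℝ≥0, ℝ)) (δ : ℝ) (B : Set Ω) {c : ℝ} (hc : 0 ≤ c) {p : ℕ → Ω → Prop}
    (hp : ∀ k ω ω', ω' ∈ germAtom drv δ k ω → (p k ω' ↔ p k ω))
    (hpB : ∀ k ω, p k ω → c * P.real (germAtom drv δ k ω) ≤ P.real (B ∩ germAtom drv δ k ω)) :
    c * P.real {ω | ∃ k, p k ω} ≤ P.real B := by
  classical
  -- the stopped atoms: germ atoms taken at a first step at which `p` holds
  obtain ⟨T, hT⟩ : ∃ T : Finset (Set Ω),
      ∀ s, s ∈ T ↔ ∃ k ω, p k ω ∧ (∀ j < k, ¬ p j ω) ∧ s = germAtom drv δ k ω :=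
    ⟨Finset.univ.filter fun s ↦ ∃ k ω, p k ω ∧ (∀ j < k, ¬ p j ω) ∧ s = germAtom drv δ k ω,
      fun s ↦ by simp only [Finset.mem_filter, Finset.mem_univ, true_and]⟩
  -- they cover the event
  have hcover : {ω | ∃ k, p k ω} ⊆ ⋃ s ∈ T, s := by
    intro ω hω
    rw [mem_setOf_eq] at hω
    obtain ⟨k, hk, hmin⟩ : ∃ k, p k ω ∧ ∀ j < k, ¬ p j ω :=
      ⟨Nat.find hω, Nat.find_spec hω, fun j hj ↦ Nat.find_min hω hj⟩
    exact mem_iUnion₂.2 ⟨germAtom drv δ k ω, (hT _).2 ⟨k, ω, hk, hmin, rfl⟩, mem_germAtom_self k ω⟩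
  -- and the pieces of `B` they carry are pairwise disjoint
  have hdisj : (↑T : Set (Set Ω)).PairwiseDisjoint fun s ↦ B ∩ s := by
    intro s hs t ht hst
    obtain ⟨k, ω, hk, hmin, rfl⟩ := (hT s).1 (Finset.mem_coe.1 hs)
    obtain ⟨k', ω', hk', hmin', rfl⟩ := (hT t).1 (Finset.mem_coe.1 ht)
    exact disjoint_left.2 fun ω'' h h' ↦
      hst (germAtom_eq_of_isFirst_of_mem hp hk hmin hk' hmin' h.2 h'.2)
  calc c * P.real {ω | ∃ k, p k ω}
      ≤ c * P.real (⋃ s ∈ T, s) :=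
        mul_le_mul_of_nonneg_left (measureReal_mono hcover (measure_ne_top _ _)) hc
    _ ≤ c * ∑ s ∈ T, P.real s :=
        mul_le_mul_of_nonneg_left (measureReal_biUnion_finset_le T fun s ↦ s) hc
    _ = ∑ s ∈ T, c * P.real s := Finset.mul_sum _ _ _
    _ ≤ ∑ s ∈ T, P.real (B ∩ s) := Finset.sum_le_sum fun s hs ↦ by
        obtain ⟨k, ω, hk, -, rfl⟩ := (hT s).1 hs
        exact hpB k ω hk
    _ = P.real (⋃ s ∈ T, B ∩ s) :=
        (measureReal_biUnion_finset hdisj fun s _ ↦ (Set.toFinite _).measurableSet).symm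
    _ ≤ P.real B := measureReal_mono (iUnion₂_subset fun s _ ↦ inter_subset_left)

/-- **Doob's maximal inequality for conditional probabilities along the germ filtration**
(finite probability space): `c · P(∃ k, P(B | 𝒢_k) ≥ c) ≤ P(B)` for the filtration `𝒢_k`
whose atoms are the germ atoms `germAtom drv δ k ω`, written division-free with
`P(B | 𝒢_k)(ω) = P(B ∩ A) / P(A)`, `A = germAtom drv δ k ω`. [folklore] -/
theorem measureReal_setOf_exists_condProb_ge_le (P : Measure Ω) [IsFiniteMeasure P]
    (drv : Ω → C(ℝ≥0, ℝ)) (δ : ℝ) (B : Set Ω) {c : ℝ} (hc : 0 < c) :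
    c * P.real {ω | ∃ k, c * P.real (germAtom drv δ k ω) ≤ P.real (B ∩ germAtom drv δ k ω)} ≤
      P.real B :=
  mul_measureReal_setOf_exists_le P drv δ B hc.le
    (p := fun k ω ↦ c * P.real (germAtom drv δ k ω) ≤ P.real (B ∩ germAtom drv δ k ω))
    (fun _ _ _ h ↦ by simp only [germAtom_eq_of_mem h]) fun _ _ h ↦ h

/-- **The violation event of the key estimate is small when violating atoms see a rare bad
event.** If every germ atom before the horizon `N` that violates one of the two
Lawler–Schramm–Werner key bounds (`germViol`) carries conditional probability at least `c > 0` of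
an event `B`, then `P {∃ k < N, germViol … k} ≤ P(B) / c` (Doob's maximal inequality
`mul_measureReal_setOf_exists_le` for the atomwise predicate `k < N ∧ germViol … k`, which
depends only on the germ atom by `germViol_congr`). [folklore] -/
theorem measureReal_setOf_germViol_le_of_condProb (P : Measure Ω) [IsFiniteMeasure P]
    (drv : Ω → C(ℝ≥0, ℝ)) (δ κ C₁ C₂ : ℝ) (N : ℕ) (B : Set Ω) {c : ℝ} (hc : 0 < c)
    (h : ∀ k < N, ∀ ω, germViol P drv δ κ C₁ C₂ k ω →
      c * P.real (germAtom drv δ k ω) ≤ P.real (B ∩ germAtom drv δ k ω)) :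
    P.real {ω | ∃ k < N, germViol P drv δ κ C₁ C₂ k ω} ≤ P.real B / c := by
  rw [le_div_iff₀' hc]
  exact mul_measureReal_setOf_exists_le P drv δ B hc.le
    (p := fun k ω ↦ k < N ∧ germViol P drv δ κ C₁ C₂ k ω)
    (fun k ω ω' hω' ↦ and_congr_right fun _ ↦ germViol_congr (germAtom_eq_of_mem hω'))
    fun k ω hk ↦ h k hk.1 ω hk.2

end Doob

end Literature.Probability.RandomPlanarGeometry.SkorokhodEmbedding

end
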